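import Literature.AnabelianGeometry.AbsoluteAnabelian.UnitKummerCyclotomeJunction
import HarnessLib

/-!
# [AbsTopIII] Prop 3.3 (i) clause (c), `TCG`: the presented cyclotome class is INDEPENDENT of the chosen junction

S. Mochizuki, *Topics in absolute anabelian geometry III*, §3, Prop. 3.3 (i) p. 73 (bib key `MochizukiAbsTopIII2015`): for
`T = TCG` the natural isomorphism `μ_Ẑ(M) ⥲ μ_Ẑ(G)` is «only determined up to a `Ẑ^×`-multiple».

abc-iut cell, layer L4, addendum to row «P33i-CYC-JUNCTION» (seat abc-iut-w4-d009 gen 4).  PROOF-ONLY, 0 defs.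
`UnitKummerCyclotomeJunction.lean` (p432997) composes the cyclotome class of a unit Kummer theory with a CHOSEN identification
`g : Λ(k̄ˣ) ≃* μ_Ẑ(G_k)` (`UnitKummerTheory.mapCyclotome`); abc-iut-w6-d022's `GaloisCyclotomeReciprocityTwist.lean` (p433978)
records that the reciprocity data behind the choice are not unique.  For `T = TCG` this does not matter: the class of a `TCG`
unit Kummer theory is the FULL torsor under `Aut μ_Ẑ(M)` (`cycIsoClass_full`, the `TLG`-condition being vacuous), so a change
of the target identification `g ↦ g'` — a post-composition with `w = g⁻¹g' ∈ Aut N` — is absorbed as the pre-composition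
with `e⁻¹ w e ∈ Aut μ_Ẑ(M)`:

* `UnitKummerTheory.trans_mem_cycIsoClass_of_TCG` — a `TCG` class is closed under post-composition with automorphisms of
  its target;
* **`UnitKummerTheory.mapCyclotome_cycIsoClass_eq_of_TCG`** — `(U.mapCyclotome g).cycIsoClass = (U.mapCyclotome g').cycIsoClass`
  for ANY two `g, g' : μ ≃* N`;
* **`GaloisMonoidPair.TCGPresentation.unitKummerTheoryMuZhat_cycIsoClass_eq_mapCyclotome`** — the class of
  `π.unitKummerTheoryMuZhat` (target the group-theoretic `μ_Ẑ(G_k)`) equals the class obtained from ANY identification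
  `Λ(k̄ˣ) ≃* μ_Ẑ(G_k)`: for `TCG`, clause (c) against `μ_Ẑ(G_k)` is at print strength with no dependence on the chosen datum.
(For `T = TLG` the class `{ge, ge∘inv}` does depend on the datum beyond `±1`; print's `{±1}` is relative to the Rmk. 3.2.1-normalised
`μ_Ẑ(G)` — not addressed here.)  Classical; nothing here bears on [IUTchIII] Cor. 3.12; no side taken.
-/

noncomputable section

namespace Literature.AnabelianGeometry.AbsoluteAnabelian

universe u

namespace UnitKummerTheory

variable {P : GaloisMonoidPair.{u}}

/-- A `TCG` cyclotome class is closed under POST-composition with any automorphism `w` of its target: `e ≫ w = (e⁻¹ w e)* e`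
and the class is the full `Aut μ_Ẑ(M)`-torsor. [cite: MochizukiAbsTopIII2015, Proposition 3.3 (i) p.73] -/
theorem trans_mem_cycIsoClass_of_TCG (U : UnitKummerTheory .TCG P) {e : cyclotome P.M ≃* U.muG} (he : e ∈ U.cycIsoClass)
    (w : U.muG ≃* U.muG) : e.trans w ∈ U.cycIsoClass := by
  obtain ⟨e₂, he₂, hcomp⟩ := U.cycIsoClass_full e he ((e.trans w).trans e.symm) (fun h => PairType.noConfusion h)
  have heq : e₂ = e.trans w := MulEquiv.ext fun ζ => by
    rw [hcomp, MulEquiv.trans_apply, MulEquiv.trans_apply, MulEquiv.apply_symm_apply]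
  exact heq ▸ he₂

/-- **For `TCG` the change of cyclotome target does not depend on the identification used**: any two `g, g' : μ ≃* N` give the
same class. [cite: MochizukiAbsTopIII2015, Proposition 3.3 (i) p.73] -/
theorem mapCyclotome_cycIsoClass_eq_of_TCG (U : UnitKummerTheory .TCG P) {N : Type u} [CommGroup N] (g g' : U.muG ≃* N) :
    (U.mapCyclotome g).cycIsoClass = (U.mapCyclotome g').cycIsoClass := by
  have key : ∀ (g g' : U.muG ≃* N), (U.mapCyclotome g).cycIsoClass ⊆ (U.mapCyclotome g').cycIsoClass := by
    intro g g'
    rintro _ ⟨e, he, rfl⟩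
    refine ⟨e.trans (g.trans g'.symm), U.trans_mem_cycIsoClass_of_TCG he _, MulEquiv.ext fun ζ => ?_⟩
    change g' (g'.symm (g (e ζ))) = g (e ζ)
    rw [MulEquiv.apply_symm_apply]
  exact Set.Subset.antisymm (key g g') (key g' g)

end UnitKummerTheory

namespace GaloisMonoidPair.TCGPresentation

variable {P : GaloisMonoidPair.{0}} (π : P.TCGPresentation)

/-- **Prop 3.3 (i) clause (c), `TCG`, choice-independence**: the cyclotome class of `π.unitKummerTheoryMuZhat` (target the
group-theoretic `μ_Ẑ(G_k)`, built on CHOSEN reciprocity data) coincides with the class obtained from ANY identification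
`g : Λ(k̄ˣ) ≃* μ_Ẑ(G_k)` — the `Ẑ^×`-torsor absorbs the choice. [cite: MochizukiAbsTopIII2015, Proposition 3.3 (i) p.73] -/
theorem unitKummerTheoryMuZhat_cycIsoClass_eq_mapCyclotome
    (g : Literature.AnabelianGeometry.EtaleTheta.cyclotome (π.C.K)ˣ ≃* muZhat (Field.absoluteGaloisGroup π.C.k)) :
    π.unitKummerTheoryMuZhat.cycIsoClass = (π.unitKummerTheory.mapCyclotome g).cycIsoClass :=
  π.unitKummerTheory.mapCyclotome_cycIsoClass_eq_of_TCG _ g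

end GaloisMonoidPair.TCGPresentation

end Literature.AnabelianGeometry.AbsoluteAnabelian

end
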